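import Literature.NumberTheory.GaloisRepresentations.LocalDualityTwoZero
import Literature.NumberTheory.GaloisRepresentations.LocalGlobalCohomologyDualityProofs
import Mathlib.GroupTheory.Coset.Card
import Mathlib.GroupTheory.QuotientGroup.Basic
import HarnessLib

/-!
# `#H²(F, V) ≤ #(V ⧸ (g₀ − c)·V)`: local duality in bidegree `(2, 0)` bounded by the `c`-eigenvectors of one
# Galois element (theorems only — no definition, no named fact, no instance, no `sorry`)

Topic `NumberTheory/GaloisRepresentations` (sequel of `LocalDualityTwoZero`: the tree's PROVED numerical local duality
`natCard_two_eq_natCard_invariants_homRep`, `#H²(F, V) = #Hom_{Γ_F}(V, μ_{p^k})` for a finite discrete `Γ_F`-module `V`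
killed by `p^k` over a non-archimedean local field `F` of characteristic `0`).  Brick (F4c-1) of the uniform-`ι` road of
cell `pub/bsd-print-x9` (stub `stub_h5bAtS`; design x9-p1-w3 g6 2026-08-28T21:10:46Z/21:21:11Z: «H² exponents by COUNT»).

For ONE element `g₀ ∈ Γ_F` acting on the cyclic group `μ_{p^k}(F̄)` by an INTEGER `c` (`g₀ ζ = c·ζ`; any automorphism of a
cyclic group is multiplication by an integer — no cyclotomic-character API is needed), every `Γ_F`-equivariant additive map
`f : V → μ_{p^k}` satisfies `f(g₀ v) = g₀ f(v) = c·f(v)`, i.e. kills the subgroup `(g₀ − c)·V = {τ(g₀) v − c·v}`.  Hence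

* `natCard_two_le_natCard_quotient_of_mu_apply_eq_smul` — **`#H²(F, V) ≤ #(V ⧸ R)` for every subgroup
  `R ≤ (g₀ − c)·V`** (the equivariant maps inject into `Hom(V ⧸ R, μ_{p^k})`, which has `#(V ⧸ R)` elements,
  `Nat.card_addMonoidHom_zmod` after `muEquivZMod`); with `Finite (H²(F, V))`;
* `natCard_two_le_natCard_eigen_of_mu_apply_eq_smul` — **`#H²(F, V) ≤ #{v | τ(g₀) v = c·v}`** (`R = (g₀ − c)·V` itself;
  rank–nullity `#(V ⧸ φ(V)) = #ker φ` for the endomorphism `φ = τ(g₀) − c`).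

In the application (Howard's Eisenstein levels at `w ∣ p`, `g₀` with `κ(g₀) = p^s`): on a LINE `L` (a cyclic
`A_{m,k}`-module on which `g₀` acts by a scalar `uλ`) one has `(g₀ − c)·L ⊇ [T]^{p^s}·L`, so `#H²(K_w, L) ≤ #(A_{m,k}/[T]^{p^s})
= p^{p^s}` uniformly; on the rank-two levels the Cayley–Hamilton bound of (B4) controls the eigenvectors.  No summit statement
is proved; BSD is not proved by any of this.

References: [MilneADT2006] J. S. Milne, *Arithmetic Duality Theorems* (2006), I Cor. 2.3 (`H²(K, M) ≅ Hom_G(M, μ)^*`) and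
Prop. 0.19; [SerreGaloisCohomology1997] II §5.2 Thm. 2; [Howard2004HeegnerKolyvagin] Lemma 3.2.7 (arXiv:1202.6340 p. 16
L150–156: «by local duality it suffices to bound `H⁰(K_v, gr_v 𝐀)`»).
-/

set_option autoImplicit false

noncomputable section

open Function Field

universe u

namespace Literature.NumberTheory.GaloisRepresentations

open DiscreteGaloisModule ContinuousRep

section Local

variable (F : Type u) [Field F] [ValuativeRel F] [TopologicalSpace F] [IsNonarchimedeanLocalField F] [CharZero F]
variable {V : Type u} [AddCommGroup V] [TopologicalSpace V] [DiscreteTopology V] [Finite V]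

omit [TopologicalSpace V] [DiscreteTopology V] in
/-- Rank–nullity for an endomorphism of a finite abelian group: `#(V ⧸ φ(V)) = #ker φ`. [folklore] -/
private theorem natCard_quotient_range_eq_natCard_ker (φ : V →+ V) : Nat.card (V ⧸ φ.range) = Nat.card φ.ker := by
  have h1 : Nat.card V = Nat.card (V ⧸ φ.range) * Nat.card φ.range :=
    AddSubgroup.card_eq_card_quotient_mul_card_addSubgroup φ.range
  have h2 : Nat.card V = Nat.card (V ⧸ φ.ker) * Nat.card φ.ker :=
    AddSubgroup.card_eq_card_quotient_mul_card_addSubgroup φ.ker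
  have h3 : Nat.card (V ⧸ φ.ker) = Nat.card φ.range := Nat.card_congr (QuotientAddGroup.quotientKerEquivRange φ).toEquiv
  haveI : Nonempty φ.range := ⟨0⟩
  have hpos : 0 < Nat.card φ.range := Nat.card_pos
  rw [h3, mul_comm] at h2
  rw [h2] at h1
  exact Nat.eq_of_mul_eq_mul_right hpos h1.symm

/-- **`#H²(F, V) ≤ #(V ⧸ R)` for `R ≤ (g₀ − c)·V`.**  Let `F` be a non-archimedean local field of characteristic `0`,
`V` a finite discrete `Γ_F`-module killed by `p^k` (`p` prime), `g₀ ∈ Γ_F` acting on `μ_{p^k}(F̄)` as multiplication by the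
integer `c`, and `R ≤ V` a subgroup all of whose elements are of the form `τ(g₀) v − c·v`.  Then `H²(F, V)` is finite and
`#H²(F, V) ≤ #(V ⧸ R)`: by local duality `#H²(F, V) = #Hom_{Γ_F}(V, μ_{p^k})` (tree `natCard_two_eq_natCard_invariants_homRep`),
an equivariant `f` has `f(τ(g₀) v) = g₀·f(v) = c·f(v)` and so factors through `V ⧸ R`, and `#Hom(V ⧸ R, μ_{p^k}) = #(V ⧸ R)`
(`μ_{p^k} ≅ ℤ/p^k`, `Nat.card_addMonoidHom_zmod`).
[cite: MilneADT2006, Ch. I Cor. 2.3 and Prop. 0.19] [cite: SerreGaloisCohomology1997, Ch. II §5.2 Thm. 2] -/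
theorem natCard_two_le_natCard_quotient_of_mu_apply_eq_smul {p k : ℕ} [hp : Fact p.Prime]
    (τ : ContinuousRep (absoluteGaloisGroup F) ℤ V) (hM : ∀ v : V, p ^ k • v = 0)
    (g₀ : absoluteGaloisGroup F) (c : ℤ) (hc : ∀ ζ : MuCarrier F (p ^ k), mu F (p ^ k) g₀ ζ = c • ζ)
    (R : AddSubgroup V) (hR : ∀ r ∈ R, ∃ v : V, τ g₀ v - c • v = r) :
    Finite (continuousCohomology 2 τ.toTopRep) ∧
      Nat.card (continuousCohomology 2 τ.toTopRep) ≤ Nat.card (V ⧸ R) := by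
  classical
  haveI : NeZero (p ^ k) := ⟨pow_ne_zero k hp.out.ne_zero⟩
  haveI : Finite (MuCarrier F (p ^ k)) := finite_muCarrier F (p ^ k)
  obtain ⟨hfin, hcard⟩ := natCard_two_eq_natCard_invariants_homRep F τ hM
  refine ⟨hfin, ?_⟩
  rw [hcard]
  -- an invariant of the dual `V^D = Hom(V, μ)` is an equivariant map, which kills `R`
  let toHom : (τ.homRep (mu F (p ^ k))).toTopRep.ρ.invariants → (V →+ MuCarrier F (p ^ k)) := fun f ↦
    (f : HomCarrier V (MuCarrier F (p ^ k)))
  have htoHom : ∀ (f : (τ.homRep (mu F (p ^ k))).toTopRep.ρ.invariants) (v : V),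
      toHom f v = (f : HomCarrier V (MuCarrier F (p ^ k))) v := fun _ _ ↦ rfl
  have hkill : ∀ (f : (τ.homRep (mu F (p ^ k))).toTopRep.ρ.invariants) (r : V), r ∈ R → toHom f r = 0 := by
    intro f r hr
    obtain ⟨v, rfl⟩ := hR r hr
    have hf : ∀ σ, τ.homRep (mu F (p ^ k)) σ (f : HomCarrier _ _) = f := f.2
    have heq : mu F (p ^ k) g₀ ((f : HomCarrier V (MuCarrier F (p ^ k))) v) =
        (f : HomCarrier V (MuCarrier F (p ^ k))) (τ g₀ v) :=
      (ContinuousRep.homRep_apply_eq_self_iff τ _ g₀ _).mp (hf g₀) v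
    rw [map_sub, map_zsmul, htoHom, htoHom, ← heq, hc, sub_self]
  -- the injection `Hom_Γ(V, μ) ↪ Hom(V ⧸ R, μ)`
  let Ψ : (τ.homRep (mu F (p ^ k))).toTopRep.ρ.invariants → (V ⧸ R →+ MuCarrier F (p ^ k)) := fun f ↦
    QuotientAddGroup.lift R (toHom f) (fun r hr ↦ (AddMonoidHom.mem_ker).mpr (hkill f r hr))
  have hΨ : Injective Ψ := by
    intro f₁ f₂ h
    apply Subtype.ext
    refine HomCarrier.ext fun v ↦ ?_
    have h' := DFunLike.congr_fun h (QuotientAddGroup.mk v)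
    change QuotientAddGroup.lift R (toHom f₁) _ (QuotientAddGroup.mk v) =
      QuotientAddGroup.lift R (toHom f₂) _ (QuotientAddGroup.mk v) at h'
    rw [QuotientAddGroup.lift_mk', QuotientAddGroup.lift_mk', htoHom, htoHom] at h'
    exact h'
  haveI : Finite (V ⧸ R →+ MuCarrier F (p ^ k)) :=
    Finite.of_injective (fun f : (V ⧸ R →+ MuCarrier F (p ^ k)) ↦ (f : V ⧸ R → MuCarrier F (p ^ k)))
      DFunLike.coe_injective
  -- `#Hom(V ⧸ R, μ_{p^k}) = #Hom(V ⧸ R, ℤ/p^k) = #(V ⧸ R)`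
  have hRk : ∀ x : V ⧸ R, (p ^ k) • x = 0 := by
    intro x
    induction x using QuotientAddGroup.induction_on with
    | H v => rw [← QuotientAddGroup.mk_nsmul, hM v, QuotientAddGroup.mk_zero]
  have hHom : Nat.card (V ⧸ R →+ MuCarrier F (p ^ k)) = Nat.card (V ⧸ R) := by
    rw [Nat.card_congr (AddEquiv.addMonoidHomCongrRightEquiv (M := V ⧸ R) (muEquivZMod F (p ^ k))),
      Nat.card_addMonoidHom_zmod hRk]
  calc Nat.card (τ.homRep (mu F (p ^ k))).toTopRep.ρ.invariants
      ≤ Nat.card (V ⧸ R →+ MuCarrier F (p ^ k)) := Nat.card_le_card_of_injective Ψ hΨ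
    _ = Nat.card (V ⧸ R) := hHom

/-- **`#H²(F, V) ≤ #{v | τ(g₀) v = c·v}`** (the `c`-eigenvectors of `g₀` on `V`), under the hypotheses of
`natCard_two_le_natCard_quotient_of_mu_apply_eq_smul` — the case `R = (g₀ − c)·V` read through rank–nullity
`#(V ⧸ φ(V)) = #ker φ` for `φ = τ(g₀) − c`.  In Howard's setting (`κ(g₀) = p^s`) these eigenvectors are controlled by the
Cayley–Hamilton bound of the (B4) brick. [cite: MilneADT2006, Ch. I Cor. 2.3] [cite: Howard2004HeegnerKolyvagin, Lemma 3.2.7 (arXiv:1202.6340 p. 16 L150–156)] -/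
theorem natCard_two_le_natCard_eigen_of_mu_apply_eq_smul {p k : ℕ} [hp : Fact p.Prime]
    (τ : ContinuousRep (absoluteGaloisGroup F) ℤ V) (hM : ∀ v : V, p ^ k • v = 0)
    (g₀ : absoluteGaloisGroup F) (c : ℤ) (hc : ∀ ζ : MuCarrier F (p ^ k), mu F (p ^ k) g₀ ζ = c • ζ) :
    Finite (continuousCohomology 2 τ.toTopRep) ∧
      Nat.card (continuousCohomology 2 τ.toTopRep) ≤ Nat.card {v : V // τ g₀ v = c • v} := by
  let φ : V →+ V := (τ g₀).toAddMonoidHom - c • AddMonoidHom.id V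
  have hφ : ∀ v : V, φ v = τ g₀ v - c • v := fun _ ↦ rfl
  obtain ⟨hfin, hle⟩ := natCard_two_le_natCard_quotient_of_mu_apply_eq_smul F τ hM g₀ c hc φ.range
    (by rintro _ ⟨v, rfl⟩; exact ⟨v, (hφ v).symm⟩)
  refine ⟨hfin, hle.trans ?_⟩
  rw [natCard_quotient_range_eq_natCard_ker φ]
  refine (Nat.card_congr (Equiv.subtypeEquivRight fun v ↦ ?_)).le
  rw [AddMonoidHom.mem_ker, hφ, sub_eq_zero]

end Local

end Literature.NumberTheory.GaloisRepresentations
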